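import Mathlib
import Summits.Schanuel.Schanuel.Theses.DiophantineDichotomy

/-!
# Sketch (crux-ideate round 1, ideator 2) — crux stmt-Schanuel-6116 `DiophantineDichotomy.KhovanskiiApproxType`

Checked statements for
* the RACE-COMPACTNESS remark (route-level restatement signal): the eventual-in-height approximation
  type `KhovanskiiApproxTypeEv`, the fact that the typed crux implies it, and the signature of the
  eventual race `ApproximationRaceEv : ApproximationProperty → KhovanskiiApproxTypeEv → KhovanskiiSchanuel`
  (proof = fixed-Δ compactness argument, written out in RaceCompactness.md; M-sized prover work);
* the idea card `height-window-compactness`: the height-window decomposition of the TYPED crux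
  (`approxTypeAt_of_above_of_below`, `approxTypeBelowAt_of_polyFloor`, proved) and its stubs;
* the (d,h)-currency variants (triage F2 restatement signal) `ApproxTypeDhAt` / `KhovanskiiApproxTypeDhEv`.
-/

namespace Summit.Schanuel.Schanuel.Cruxes.KhovanskiiApproxType.Ideate2

open Summit.Schanuel.Schanuel.Theses.DiophantineDichotomy

noncomputable section

/-- `s` is a free Khovanskii point: ℚ-linearly independent coordinates and a non-degenerate zero of a
Khovanskii system over ℚ (verbatim the hypothesis of the crux). -/
def IsFreeKhovanskiiPoint (n : ℕ) (s : Fin n → ℂ) : Prop :=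
  LinearIndependent ℚ s ∧
    ∃ g : Fin n → MvPolynomial (Fin n ⊕ Fin n) ℚ,
      (∀ i, MvPolynomial.aeval (Sum.elim s (Complex.exp ∘ s)) (g i) = 0) ∧
        (Matrix.of fun i j =>
            MvPolynomial.aeval (Sum.elim s (Complex.exp ∘ s))
              (MvPolynomial.pderiv (Sum.inl j) (g i) +
                MvPolynomial.X (Sum.inr j) * MvPolynomial.pderiv (Sum.inr j) (g i))).det ≠ 0

/-- The crux's challenger clauses: `γ` algebraic with `[ℚ(γ):ℚ] ≤ d`, every coordinate a root of a
non-zero integer polynomial of degree `≤ d` and naive height `≤ H`. -/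
def IsChallenger {ι : Type*} (γ : ι → ℂ) (d H : ℕ) : Prop :=
  Module.finrank ℚ ↥(IntermediateField.adjoin ℚ (Set.range γ)) ≤ d ∧
    ∀ i, ∃ P : Polynomial ℤ, P ≠ 0 ∧ P.natDegree ≤ d ∧ (∀ k, |P.coeff k| ≤ (H : ℤ)) ∧
      Polynomial.aeval (γ i) P = 0

/-- The point θ = (s, e^s) ∈ ℂ^{2n}. -/
def theta (n : ℕ) (s : Fin n → ℂ) : Fin n ⊕ Fin n → ℂ := Sum.elim s (Complex.exp ∘ s)

/-- The crux's lower bound exp(−C(dᵃ log H + dᵇ)). -/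
def bound (a b C : ℝ) (d H : ℕ) : ℝ :=
  Real.exp (-(C * ((d : ℝ) ^ a * Real.log H + (d : ℝ) ^ b)))

/-- Pointwise approximation type (a, b, C) at θ = (s, e^s): the crux's conclusion at one point, ALL heights. -/
def ApproxTypeAt (n : ℕ) (s : Fin n → ℂ) (a b C : ℝ) : Prop :=
  ∀ (d H : ℕ) (γ : Fin n ⊕ Fin n → ℂ), IsChallenger γ d H → bound a b C d H ≤ ‖γ - theta n s‖

/-- EVENTUAL (in the height) approximation type at θ: for every degree bound `d` the crux's lower bound is
required only for `H ≥ H₀(d)`, with an ARBITRARY (ineffective) threshold `H₀ : ℕ → ℕ`.  This is all the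
exponent race needs (RaceCompactness.md). -/
def ApproxTypeEvAt (n : ℕ) (s : Fin n → ℂ) (a b C : ℝ) : Prop :=
  ∀ d : ℕ, ∃ H₀ : ℕ, ∀ (H : ℕ) (γ : Fin n ⊕ Fin n → ℂ), H₀ ≤ H → IsChallenger γ d H →
    bound a b C d H ≤ ‖γ - theta n s‖

/-- PROPOSED REPLACEMENT ITEM (restatement signal for tenure): the eventual form of the crux. -/
def KhovanskiiApproxTypeEv : Prop :=
  ∀ (n : ℕ) (s : Fin n → ℂ), 2 ≤ n → IsFreeKhovanskiiPoint n s →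
    ∃ a b C : ℝ, a < 1 / ((n : ℝ) - 1) ∧ 0 < C ∧ ApproxTypeEvAt n s a b C

/-- The crux, reassembled pointwise (bookkeeping: the crux is `∀ free Khovanskii θ, ∃ a<1/(n−1), b, C, ApproxTypeAt`). -/
theorem khovanskiiApproxType_iff :
    KhovanskiiApproxType ↔
      ∀ (n : ℕ) (s : Fin n → ℂ), 2 ≤ n → IsFreeKhovanskiiPoint n s →
        ∃ a b C : ℝ, a < 1 / ((n : ℝ) - 1) ∧ 0 < C ∧ ApproxTypeAt n s a b C := by
  unfold KhovanskiiApproxType IsFreeKhovanskiiPoint ApproxTypeAt IsChallenger bound theta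
  constructor
  · intro h n s hn hθ
    obtain ⟨a, b, C, ha, hC, hm⟩ := h n s hn hθ.1 hθ.2
    exact ⟨a, b, C, ha, hC, fun d H γ hγ => hm d H γ hγ.1 hγ.2⟩
  · intro h n s hn hli hg
    obtain ⟨a, b, C, ha, hC, hm⟩ := h n s hn ⟨hli, hg⟩
    exact ⟨a, b, C, ha, hC, fun d H γ h1 h2 => hm d H γ ⟨h1, h2⟩⟩

/-- all heights ⇒ eventually in the height (threshold 0). -/
theorem approxTypeEvAt_of_approxTypeAt {n : ℕ} {s : Fin n → ℂ} {a b C : ℝ}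
    (h : ApproxTypeAt n s a b C) : ApproxTypeEvAt n s a b C :=
  fun d => ⟨0, fun H γ _ hγ => h d H γ hγ⟩

/-- The typed crux implies its eventual form (so the proposed item is a WEAKENING of 6116). -/
theorem khovanskiiApproxTypeEv_of_khovanskiiApproxType (h : KhovanskiiApproxType) :
    KhovanskiiApproxTypeEv := by
  intro n s hn hθ
  obtain ⟨a, b, C, ha, hC, hm⟩ := khovanskiiApproxType_iff.mp h n s hn hθ
  exact ⟨a, b, C, ha, hC, approxTypeEvAt_of_approxTypeAt hm⟩

/-- PROPOSED SUPPORT ITEM (replaces `ApproximationRace` 6119 if tenure restates 6116 as the eventual form):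
the exponent race needs the measure only eventually in H.  Proof (RaceCompactness.md): assume trdeg ≤ n−1,
get c from `ApproximationProperty`, FIX Δ with Δ^{1−(n−1)a} > c^{1+(n−1)a}·C and let Y → ∞; the AP outputs
have degree ≤ (cΔ)^{n−1} (bounded) and distance ≤ exp(−Y/c) → 0, so they leave every finite set of algebraic
points of bounded degree and height (θ ∉ ℚ̄^{2n} by Hermite–Lindemann); past max_{d ≤ (cΔ)^{n−1}} H₀(d) the
eventual measure applies and log H·Δ/c ≤ C dᵃ log H + C dᵇ − dY/c is impossible for large Y. -/
def ApproximationRaceEv : Prop :=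
  ApproximationProperty → KhovanskiiApproxTypeEv → KhovanskiiSchanuel

/-- stub (prover work, M): the eventual race. -/
theorem approximationRaceEv_holds : ApproximationRaceEv := by
  sorry

/-- With the eventual race the route still closes: same glue shape as the route's `closes`. -/
theorem closes_ev (hAP : ApproximationProperty) (hEv : KhovanskiiApproxTypeEv)
    (hRace : ApproximationRaceEv) (hRed : KhovanskiiReduction) : _root_.Schanuel :=
  hRed (hRace hAP hEv)

/-! ## Height windows (idea card `height-window-compactness`) -/

/-- the crux's bound above an explicit height threshold `T d` -/
def ApproxTypeAboveAt (n : ℕ) (s : Fin n → ℂ) (T : ℕ → ℕ) (a b C : ℝ) : Prop :=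
  ∀ (d H : ℕ) (γ : Fin n ⊕ Fin n → ℂ), T d ≤ H → IsChallenger γ d H → bound a b C d H ≤ ‖γ - theta n s‖

/-- the crux's bound below an explicit height threshold `T d` -/
def ApproxTypeBelowAt (n : ℕ) (s : Fin n → ℂ) (T : ℕ → ℕ) (a b C : ℝ) : Prop :=
  ∀ (d H : ℕ) (γ : Fin n ⊕ Fin n → ℂ), H < T d → IsChallenger γ d H → bound a b C d H ≤ ‖γ - theta n s‖

/-- window glue (proved): above ∧ below an explicit threshold ⇒ the pointwise crux. -/
theorem approxTypeAt_of_above_of_below {n : ℕ} {s : Fin n → ℂ} {T : ℕ → ℕ} {a b C : ℝ}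
    (hA : ApproxTypeAboveAt n s T a b C) (hB : ApproxTypeBelowAt n s T a b C) :
    ApproxTypeAt n s a b C := by
  intro d H γ hγ
  rcases lt_or_ge H (T d) with hlt | hge
  · exact hB d H γ hlt hγ
  · exact hA d H γ hge hγ

/-- above an explicit threshold ⇒ eventually (threshold `T`). -/
theorem approxTypeEvAt_of_above {n : ℕ} {s : Fin n → ℂ} {T : ℕ → ℕ} {a b C : ℝ}
    (hA : ApproxTypeAboveAt n s T a b C) : ApproxTypeEvAt n s a b C :=
  fun d => ⟨T d, fun H γ hH hγ => hA d H γ hH hγ⟩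

/-- Small-height FLOOR: below the height `T d` the distance is bounded below by exp(−C d^B) with NO height
term (at every explicit free Khovanskii point this follows from ONE coordinate with a transcendence measure
polynomial in (degree, log height): π (Waldschmidt 1978), e^β and log α (Baker / Nesterenko–Waldschmidt 1996),
provided log T d ≤ poly(d)). -/
def PolyFloorBelowAt (n : ℕ) (s : Fin n → ℂ) (T : ℕ → ℕ) (B C : ℝ) : Prop :=
  ∀ (d H : ℕ) (γ : Fin n ⊕ Fin n → ℂ), H < T d → IsChallenger γ d H →
    Real.exp (-(C * (d : ℝ) ^ B)) ≤ ‖γ - theta n s‖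

/-- floor ⇒ below-threshold layer of the crux with b := B (proved; uses only log H ≥ 0 for H : ℕ and C ≥ 0). -/
theorem approxTypeBelowAt_of_polyFloor {n : ℕ} {s : Fin n → ℂ} {T : ℕ → ℕ} {a B C : ℝ}
    (hC : 0 ≤ C) (hF : PolyFloorBelowAt n s T B C) : ApproxTypeBelowAt n s T a B C := by
  intro d H γ hH hγ
  refine le_trans ?_ (hF d H γ hH hγ)
  unfold bound
  apply Real.exp_le_exp.mpr
  have hlog : 0 ≤ Real.log (H : ℝ) := Real.log_natCast_nonneg H
  have hda : 0 ≤ (d : ℝ) ^ a := Real.rpow_nonneg (Nat.cast_nonneg d) a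
  have : 0 ≤ C * ((d : ℝ) ^ a * Real.log (H : ℝ)) := mul_nonneg hC (mul_nonneg hda hlog)
  nlinarith [this]

/-- STUB A of the card (the Ably-regime layer): at a Lindemann–Weierstrass point (s algebraic) the typed bound
holds above the double-exponential threshold T d = ⌈exp(exp(κ d² log(d+2)))⌉ with a = 3/4 + ε — from Ably 1994
(μ = 2 above the threshold), Mahler 1932 / Ably n = 1 (slot floors A = 1 above the threshold), Bombieri–Vaaler
and the slot dichotomy of the line lw-small-height.  Stated here for n = 2. -/
def LWAboveAblyTwo : Prop :=
  ∀ (s : Fin 2 → ℂ), (∀ i, IsAlgebraic ℚ (s i)) → LinearIndependent ℚ s →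
    ∃ (κ a b C : ℝ), a < 1 ∧ 0 < C ∧
      ApproxTypeAboveAt 2 s (fun d => ⌈Real.exp (Real.exp (κ * (d : ℝ) ^ 2 * Real.log (d + 2)))⌉₊) a b C

/-- STUB B of the card (the WINDOW — the only open range at LW points): the typed bound for
exp(d^{b₀}) ≤ H < the Ably threshold. -/
def LWWindowTwo : Prop :=
  ∀ (s : Fin 2 → ℂ), (∀ i, IsAlgebraic ℚ (s i)) → LinearIndependent ℚ s →
    ∀ κ : ℝ, ∃ (b₀ a b C : ℝ), a < 1 ∧ 0 < C ∧
      ∀ (d H : ℕ) (γ : Fin 2 ⊕ Fin 2 → ℂ), Real.exp ((d : ℝ) ^ b₀) ≤ H →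
        H < ⌈Real.exp (Real.exp (κ * (d : ℝ) ^ 2 * Real.log (d + 2)))⌉₊ →
          IsChallenger γ d H → bound a b C d H ≤ ‖γ - theta 2 s‖

/-- STUB C of the card (small heights, printed at LW points via Nesterenko–Waldschmidt 1996 on one slot). -/
def LWPolyFloorTwo : Prop :=
  ∀ (s : Fin 2 → ℂ), (∀ i, IsAlgebraic ℚ (s i)) → LinearIndependent ℚ s →
    ∀ b₀ : ℝ, ∃ (B C : ℝ), 0 ≤ C ∧ PolyFloorBelowAt 2 s (fun d => ⌈Real.exp ((d : ℝ) ^ b₀)⌉₊) B C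

/-! ## (d,h)-currency variants (triage F2 restatement signal), for tenure -/

/-- (d,h)-currency pointwise type: the degree-normalised height log H / m, m = a lower bound for the degrees
of the coordinates of γ, is an upper bound for max_j h(γ_j) up to log(d+1)/m; exponent written d^{1+a} so that
a = 1/n is the expected truth and a < 1/(n−1) is what the (d,h)-race needs (transfer F2: C⁺ with μ = n gives
a = 1/n for EVERY n). -/
def ApproxTypeDhAt (n : ℕ) (s : Fin n → ℂ) (a b C : ℝ) : Prop :=
  ∀ (d H m : ℕ) (γ : Fin n ⊕ Fin n → ℂ), 1 ≤ m → m ≤ d →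
    (∀ i, m ≤ Module.finrank ℚ ↥(IntermediateField.adjoin ℚ ({γ i} : Set ℂ))) → IsChallenger γ d H →
      Real.exp (-(C * ((d : ℝ) ^ (1 + a) * Real.log H / m + (d : ℝ) ^ b))) ≤ ‖γ - theta n s‖

/-- eventual (d,h)-currency type -/
def ApproxTypeDhEvAt (n : ℕ) (s : Fin n → ℂ) (a b C : ℝ) : Prop :=
  ∀ d : ℕ, ∃ H₀ : ℕ, ∀ (H m : ℕ) (γ : Fin n ⊕ Fin n → ℂ), H₀ ≤ H → 1 ≤ m → m ≤ d →
    (∀ i, m ≤ Module.finrank ℚ ↥(IntermediateField.adjoin ℚ ({γ i} : Set ℂ))) → IsChallenger γ d H →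
      Real.exp (-(C * ((d : ℝ) ^ (1 + a) * Real.log H / m + (d : ℝ) ^ b))) ≤ ‖γ - theta n s‖

/-- (d,h)-currency, eventual: the weakest form of the crux that still runs an exponent race (against
Philippon's AP in its PRINTED (d(α), d(α)h(α)) form) and that is PRINTED at every Lindemann–Weierstrass point
for every n (Ably 1994 + Bombieri–Vaaler, a = 1/n). -/
def KhovanskiiApproxTypeDhEv : Prop :=
  ∀ (n : ℕ) (s : Fin n → ℂ), 2 ≤ n → IsFreeKhovanskiiPoint n s →
    ∃ a b C : ℝ, a < 1 / ((n : ℝ) - 1) ∧ 0 < C ∧ ApproxTypeDhEvAt n s a b C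

/-- typed (all slots charged at the common d) ⇒ (d,h)-typed: with 1 ≤ m ≤ d, d^{1+a} log H / m ≥ d^a log H. -/
theorem approxTypeDhAt_of_approxTypeAt {n : ℕ} {s : Fin n → ℂ} {a b C : ℝ} (hC : 0 ≤ C)
    (h : ApproxTypeAt n s a b C) : ApproxTypeDhAt n s a b C := by
  intro d H m γ hm hmd _hdeg hγ
  refine le_trans ?_ (h d H γ hγ)
  unfold bound
  apply Real.exp_le_exp.mpr
  have hlog : 0 ≤ Real.log (H : ℝ) := Real.log_natCast_nonneg H
  have hmpos : (0 : ℝ) < m := by exact_mod_cast hm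
  have hmd' : (m : ℝ) ≤ d := by exact_mod_cast hmd
  have hdpos : (0 : ℝ) < d := lt_of_lt_of_le hmpos hmd'
  have hda : 0 ≤ (d : ℝ) ^ a := Real.rpow_nonneg (Nat.cast_nonneg d) a
  have hsplit : (d : ℝ) ^ (1 + a) = (d : ℝ) * (d : ℝ) ^ a := by
    rw [Real.rpow_add hdpos, Real.rpow_one]
  have key : (d : ℝ) ^ a * Real.log H ≤ (d : ℝ) ^ (1 + a) * Real.log H / m := by
    rw [le_div_iff₀ hmpos, hsplit]
    have h1 : (d : ℝ) ^ a * Real.log H * m ≤ (d : ℝ) ^ a * Real.log H * d :=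
      mul_le_mul_of_nonneg_left hmd' (mul_nonneg hda hlog)
    nlinarith [h1]
  nlinarith [key, hC]

/-- eventual typed ⇒ eventual (d,h)-typed -/
theorem approxTypeDhEvAt_of_approxTypeEvAt {n : ℕ} {s : Fin n → ℂ} {a b C : ℝ} (hC : 0 ≤ C)
    (h : ApproxTypeEvAt n s a b C) : ApproxTypeDhEvAt n s a b C := by
  intro d
  obtain ⟨H₀, hH₀⟩ := h d
  refine ⟨H₀, fun H m γ hH hm hmd hdeg hγ => ?_⟩
  have hall : ApproxTypeAt n s a b C → True := fun _ => trivial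
  -- reuse the pointwise inequality through a local all-heights statement at this (d, H)
  have hpt : bound a b C d H ≤ ‖γ - theta n s‖ := hH₀ H γ hH hγ
  refine le_trans ?_ hpt
  unfold bound
  apply Real.exp_le_exp.mpr
  have hlog : 0 ≤ Real.log (H : ℝ) := Real.log_natCast_nonneg H
  have hmpos : (0 : ℝ) < m := by exact_mod_cast hm
  have hmd' : (m : ℝ) ≤ d := by exact_mod_cast hmd
  have hdpos : (0 : ℝ) < d := lt_of_lt_of_le hmpos hmd'
  have hda : 0 ≤ (d : ℝ) ^ a := Real.rpow_nonneg (Nat.cast_nonneg d) a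
  have hsplit : (d : ℝ) ^ (1 + a) = (d : ℝ) * (d : ℝ) ^ a := by
    rw [Real.rpow_add hdpos, Real.rpow_one]
  have key : (d : ℝ) ^ a * Real.log H ≤ (d : ℝ) ^ (1 + a) * Real.log H / m := by
    rw [le_div_iff₀ hmpos, hsplit]
    have h1 : (d : ℝ) ^ a * Real.log H * m ≤ (d : ℝ) ^ a * Real.log H * d :=
      mul_le_mul_of_nonneg_left hmd' (mul_nonneg hda hlog)
    nlinarith [h1]
  nlinarith [key, hC]

/-- 6116 ⇒ its (d,h)-eventual form (so that restatement too is a WEAKENING). -/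
theorem khovanskiiApproxTypeDhEv_of_khovanskiiApproxType (h : KhovanskiiApproxType) :
    KhovanskiiApproxTypeDhEv := by
  intro n s hn hθ
  obtain ⟨a, b, C, ha, hC, hm⟩ := khovanskiiApproxType_iff.mp h n s hn hθ
  exact ⟨a, b, C, ha, hC, approxTypeDhEvAt_of_approxTypeEvAt hC.le (approxTypeEvAt_of_approxTypeAt hm)⟩

end

end Summit.Schanuel.Schanuel.Cruxes.KhovanskiiApproxType.Ideate2
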